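import Mathlib
import HarnessLib
import Summits.HubbardSuperconductivity.HubbardSuperconductivity.Theorems.KLProgrammeKLRegimeEngineV8E5BlockHybridScaled
import Summits.HubbardSuperconductivity.HubbardSuperconductivity.Theorems.KLProgrammeKLRegimeEngineV8E5ShareArith

/-!
# Route `KLProgramme` — ENGINE child gen 8 (stmt-HubbardSuperconductivity-20437 `KLRegimeEngineV17F2`), SKELETON v2 class #3, PROVING side:
# the E.5 block from RAW STEP DATA — all sixteen colourings dispatched (the `∃ (C,u), E5ShareStep2 P R C u` ASSEMBLY, part 1 of 3)
# (cell gate-hubbard-kl, seat p5 g9; composes `…E5BlockHybridTails` §3/§4, `…E5BlockHybridScaled`, `…E5ShareArith`)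

WHAT.  The class-#3 witness recipe of record (HOME/prover-p5/E5-GAIN-SCALE-N.md §17, r17a, r17b) is, per step `n−1 → n` at the flow frame `K`:
instance `norm_klE5Block_le_of_hybridTails_klAniso` ∘ per colouring `klE5_hybridTail_le_of_lineData_pointAugment_scaled(_of_b)` (line `0` presented RESCALED
by `λ`) ∘ RAW INPUTS ∘ `klE5_hybridPrefactor_eq` ∘ `klE5_share_arith`.  This file (with `…E5WitnessSlice`, `…E5WitnessStep`) carries that composition out ONCE
AND FOR ALL, so that the suppliers (L1: the dressed derivative line's row sums `α` and Gram half-norm `κ₀`; L2 ✓ k3c2-p2 `gram_klE5SoftLine_bgmFat_sharp_klEng`: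
`δ`, `κ₁`; the carrier's LEVEL NORMS at the two value-form prescription patterns; ONE envelope) only have to be plugged in BY NAME:

* §0 colouring bookkeeping (`#{s = 1} = 4 − #{s = 0}`; no colour-`0` leg ⇒ `s ≡ 1`);
* §1 **`norm_klE5Block_le_of_stepData_klAniso`** — at a frame `K`, step index `n₀`, family level `mf` (`1 ≤ mf`, `mf + 1 ≤ n₀`), cutoff `0 < Λ ≤ Λ_{n₀}`, ANY
  labels: from the scaled line-`0` data (`α`, `κ₀` of `λ·klE5DerivLineSym`), the soft-line data (`δ`, `κ₁` of `klE5SoftLineSym`) w.r.t. the fat family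
  `bgmFatMultiplier … mf`, the carrier's level norms `Nf k q` («`k` contracted legs free, `q` outputs prescribed») and `Ne k q` («`3` explicit contracted
  sectors, `q` outputs prescribed») w.r.t. `pointAugment (klAnisoFamily … mf) (klE5ExtMomenta Qm x y)`, `q ≤ 4`, and ONE envelope
  `∀ q ∈ Icc 1 4, (κ₀² + κ₁²)^{k−3}·(ε·Nf k q)·(ε·Ne k (4−q)) ≤ x′^{k−3}·A` (`x′ ≤ ½`):
  `‖klE5Block … κ V Λ Qm x y‖ ≤ 4!·13⁴·ε⁻¹·(16·(λ⁻¹·(1680·2⁹·(α·(88δ)²·A))))` — the SIXTEEN colourings dispatched (`≥ 1` output leg of copy `0`: main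
  form at `(m₀+1, m₁) = (q, 4−q)` pinned at such a leg; all four legs from copy `1`: the `_of_b` form at `(0, 3+1)` pinned at leg `0`), `klE5_tailConst_le`
  making the colouring constant uniform, `klE5_hybridPrefactor_eq` removing the volume;
* §2 **`norm_klE5Block_le_of_stepData_trivial`** — the twin through the trivial sectorisation (first steps; prefactor `ρ = 1`, overlap `1`, no plateau needed).

Pure composition over landed theorems; no definitions, no named facts, nothing about the model's sizes is asserted (every line datum and every vertex
size is a hypothesis); nothing asserts superconductivity.
-/

noncomputable section

namespace Summit.HubbardSuperconductivity.HubbardSuperconductivity.Theorems.KLRegimeSplit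

set_option linter.dupNamespace false -- summit = problem name (single-conjunct summit), D-0017

open Real Finset Literature.MathematicalPhysics.QuantumLattice Literature.Probability.LatticeModels GrassmannAlgebra Matrix
open Literature.MathematicalPhysics.QuantumLattice.FermiRG
open Summit.HubbardSuperconductivity.HubbardSuperconductivity.Theorems.KLProgrammeLegKernels
open Summit.HubbardSuperconductivity.HubbardSuperconductivity.Theorems.KLRegimeWick
open Summit.HubbardSuperconductivity.HubbardSuperconductivity.Theorems.EngineV8
open Summit.HubbardSuperconductivity.HubbardSuperconductivity.Theorems.TwoPointAssembly
open Summit.HubbardSuperconductivity.HubbardSuperconductivity.Theorems.TorusFourierL2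
open Summit.HubbardSuperconductivity.HubbardSuperconductivity.Theorems.DispersionFlow

/-! ## §0 Colouring bookkeeping on `Fin 4 → Fin 2` -/

section Colourings

/-- The two colour classes of a colouring of the four output legs partition them: `#{s = 1} = 4 − #{s = 0}`. [folklore] -/
theorem card_filter_eq_one_eq_four_sub (s : Fin 4 → Fin 2) :
    (univ.filter fun i => s i = 1).card = 4 - (univ.filter fun i => s i = 0).card := by
  have h := Finset.card_filter_add_card_filter_not (s := (univ : Finset (Fin 4))) (fun i => s i = 0)
  have h1 : (univ.filter fun i => ¬ s i = 0) = (univ.filter fun i => s i = 1) :=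
    filter_congr fun i _ => by have := Fin.exists_fin_two.mp ⟨s i, rfl⟩; omega
  rw [h1, card_univ, Fintype.card_fin] at h
  omega

/-- A colouring with no leg of colour `0` is identically `1`. [folklore] -/
theorem colouring_eq_one_of_not_exists (s : Fin 4 → Fin 2) (h : ¬ ∃ i, s i = 0) (i : Fin 4) : s i = 1 := by
  have := Fin.exists_fin_two.mp ⟨s i, rfl⟩
  have hi : s i ≠ 0 := fun h0 => h ⟨i, h0⟩
  omega

end Colourings

/-! ## §1 The block from RAW step data — the thin/fat pair of record, all sixteen colourings -/

section KlAniso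

variable {L M : ℕ} [NeZero L] [NeZero M] (β μ : ℝ) (K : TrigPolyC4v) (n₀ : ℕ) (κ : FreqMomentum L M × Fin 2 → ℂ)
  (V : HubbardGrassmann L M) (Λ : ℝ) (Qm : TorusSite 2 L) (x y : TorusSite 2 L × MatsubaraIdx M)

/-- **The E.5 block from RAW step data (thin/fat pair of record, ALL colourings).**  At a frame `K`, step index `n₀`, family level `m+1` with `m + 2 ≤ n₀`,
cutoff `0 < Λ ≤ Λ_{n₀}` and ANY labels: given the SCALED line-`0` data (`α` = row/column sums and `κ₀` = Gram half-norm bound of `λ·klE5DerivLineSym`, `0 < λ`),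
the soft-line data (`δ` = entries, `κ₁` = Gram half-norm bound of `klE5SoftLineSym`), both w.r.t. the fat family `bgmFatMultiplier … (m+1)`, the carrier's
level norms `Nf k q` / `Ne k q` (`q ≤ 4` outputs prescribed; contracted legs free / three explicit contracted sectors) w.r.t. the point-augmented thin family,
and ONE envelope with ratio `x′ ≤ ½`, the block is at most `4!·13⁴·ε⁻¹·(16·(λ⁻¹·(1680·2⁹·(α·(88δ)²·A))))`, `ε = imagTimeWeight β M`.
[cite: BenfattoGiulianiMastropietro2006, §2.8 (2.80)] -/
theorem norm_klE5Block_le_of_stepData_klAniso (hβ : 0 < β) {mf : ℕ} (hmf : 1 ≤ mf) (hmn : mf + 1 ≤ n₀) (hΛ0 : 0 < Λ) (hΛ : Λ ≤ klScale klE0 n₀)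
    {lam : ℝ} (hlam : 0 < lam) {α κ₀ δ κ₁ : ℝ} (hα : 0 ≤ α) (hκ₀ : 0 ≤ κ₀) (hδ : 0 ≤ δ) (hκ₁ : 0 ≤ κ₁)
    (hrow : ∀ X, ∑ Y, ‖((sectorSubMatrix L M β (bgmFatMultiplier L M klE0 β (nambuXiCT L μ K) mf)).transpose *
        normalCovariance L M (fun ks => (lam : ℂ) * klE5DerivLineSym L M β μ K n₀ κ Λ ks) *
        sectorSubMatrix L M β (bgmFatMultiplier L M klE0 β (nambuXiCT L μ K) mf)) X Y‖ ≤ α)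
    (hcol : ∀ Y, ∑ X, ‖((sectorSubMatrix L M β (bgmFatMultiplier L M klE0 β (nambuXiCT L μ K) mf)).transpose *
        normalCovariance L M (fun ks => (lam : ℂ) * klE5DerivLineSym L M β μ K n₀ κ Λ ks) *
        sectorSubMatrix L M β (bgmFatMultiplier L M klE0 β (nambuXiCT L μ K) mf)) X Y‖ ≤ α)
    (hκF₀ : ∀ Y : SpaceTimeIdx L M × SectorLeg (sectorCount mf), Y.2.2 = 0 →
      ‖sectorGramF L M β (bgmFatMultiplier L M klE0 β (nambuXiCT L μ K) mf) (fun ks => (lam : ℂ) * klE5DerivLineSym L M β μ K n₀ κ Λ ks) Y‖ ≤ κ₀)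
    (hκG₀ : ∀ Y : SpaceTimeIdx L M × SectorLeg (sectorCount mf), Y.2.2 = 1 →
      ‖sectorGramG L M β (bgmFatMultiplier L M klE0 β (nambuXiCT L μ K) mf) (fun ks => (lam : ℂ) * klE5DerivLineSym L M β μ K n₀ κ Λ ks) Y‖ ≤ κ₀)
    (hent : ∀ X Y, ‖((sectorSubMatrix L M β (bgmFatMultiplier L M klE0 β (nambuXiCT L μ K) mf)).transpose *
        normalCovariance L M (klE5SoftLineSym L M β μ K n₀ κ Λ) *
        sectorSubMatrix L M β (bgmFatMultiplier L M klE0 β (nambuXiCT L μ K) mf)) X Y‖ ≤ δ)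
    (hκF₁ : ∀ Y : SpaceTimeIdx L M × SectorLeg (sectorCount mf), Y.2.2 = 0 →
      ‖sectorGramF L M β (bgmFatMultiplier L M klE0 β (nambuXiCT L μ K) mf) (klE5SoftLineSym L M β μ K n₀ κ Λ) Y‖ ≤ κ₁)
    (hκG₁ : ∀ Y : SpaceTimeIdx L M × SectorLeg (sectorCount mf), Y.2.2 = 1 →
      ‖sectorGramG L M β (bgmFatMultiplier L M klE0 β (nambuXiCT L μ K) mf) (klE5SoftLineSym L M β μ K n₀ κ Λ) Y‖ ≤ κ₁)
    (Nf Ne : ℕ → ℕ → ℝ) (hNe0 : ∀ k q, 0 ≤ Ne k q)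
    (hNf : ∀ k ∈ Icc 3 (Fintype.card (HubbardFieldIdx L M × Fin 2) + 2), ∀ q ≤ 4, ∀ σ : Fin q → SectorLeg (sectorCount mf + 4),
      hubbardSectorKernelNorm L M β (pointAugment (klAnisoFamily L M β μ K klE0 mf) (klE5ExtMomenta Qm x y)) (prescribedTuples univ
        (Fin.append (fun _ : Fin k => (none : Option (SectorLeg (sectorCount mf + 4)))) (fun j => some (σ j))))
        (klE5Carrier L M β μ K n₀ κ V Λ) ≤ Nf k q)
    (hNe : ∀ k ∈ Icc 3 (Fintype.card (HubbardFieldIdx L M × Fin 2) + 2), ∀ q ≤ 4,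
      ∀ (τ : Fin 3 → SectorLeg (sectorCount mf + 4)) (σ : Fin q → SectorLeg (sectorCount mf + 4)),
      hubbardSectorKernelNorm L M β (pointAugment (klAnisoFamily L M β μ K klE0 mf) (klE5ExtMomenta Qm x y)) (prescribedTuples univ
        (Fin.append (fun i : Fin k => if h : (i : ℕ) < 3 then some (τ ⟨i, h⟩) else none) (fun j => some (σ j))))
        (klE5Carrier L M β μ K n₀ κ V Λ) ≤ Ne k q)
    {x' A : ℝ} (hx0 : 0 ≤ x') (hx1 : x' ≤ 1 / 2) (hA : 0 ≤ A)
    (henv : ∀ q ∈ Icc 1 4, ∀ k ∈ Icc 3 (Fintype.card (HubbardFieldIdx L M × Fin 2) + 2),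
      (κ₀ ^ 2 + κ₁ ^ 2) ^ (k - 3) * ((imagTimeWeight β M * Nf k q) * (imagTimeWeight β M * Ne k (4 - q))) ≤ x' ^ (k - 3) * A) :
    ‖klE5Block L M β μ K n₀ κ V Λ Qm x y‖ ≤
      ((4 : ℕ).factorial : ℝ) * 13 ^ 4 * (imagTimeWeight β M)⁻¹ * (16 * (lam⁻¹ * ((1680 * 2 ^ 9) * (α * (88 * δ) ^ 2 * A)))) := by
  classical
  obtain ⟨m, rfl⟩ : ∃ m, mf = m + 1 := ⟨mf - 1, by omega⟩
  have hm : m + 2 ≤ n₀ := by omega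
  have hm' : (m + 1) + 1 ≤ n₀ := by omega
  -- the pinned leg of a colouring: one of colour `0` if there is one, else leg `0`
  obtain ⟨p, hp0, hp1⟩ : ∃ p : (Fin 4 → Fin 2) → Fin 4,
      (∀ s : Fin 4 → Fin 2, (∃ i, s i = 0) → s (p s) = 0) ∧ (∀ s : Fin 4 → Fin 2, (¬ ∃ i, s i = 0) → p s = 0) :=
    ⟨fun s : Fin 4 → Fin 2 => if h : ∃ i, s i = 0 then h.choose else (0 : Fin 4),
      fun s h => by dsimp only; rw [dif_pos h]; exact h.choose_spec, fun s h => by dsimp only; rw [dif_neg h]⟩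
  -- the two-symbol family (line `0` rescaled) and its Gram constants
  obtain ⟨sym, hsym0, hsym1⟩ : ∃ sym : Fin 2 → FreqMomentum L M × Fin 2 → ℂ,
      sym 0 = (fun ks => (lam : ℂ) * klE5DerivLineSym L M β μ K n₀ κ Λ ks) ∧ sym 1 = klE5SoftLineSym L M β μ K n₀ κ Λ :=
    ⟨![fun ks => (lam : ℂ) * klE5DerivLineSym L M β μ K n₀ κ Λ ks, klE5SoftLineSym L M β μ K n₀ κ Λ], rfl, rfl⟩
  obtain ⟨κg, hκg0, hκg1⟩ : ∃ κg : Fin 2 → ℝ, κg 0 = κ₀ ∧ κg 1 = κ₁ := ⟨![κ₀, κ₁], rfl, rfl⟩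
  have hκg : ∀ t, 0 ≤ κg t := by
    rw [Fin.forall_fin_two, hκg0, hκg1]; exact ⟨hκ₀, hκ₁⟩
  have hκsum : ∑ t, κg t ^ 2 = κ₀ ^ 2 + κ₁ ^ 2 := by rw [Fin.sum_univ_two, hκg0, hκg1]
  have hsym : ∀ t ks, sym t ks ≠ 0 → ∑ ω, klAnisoFamily L M β μ K klE0 (m + 1) ω ks.1 = 1 := by
    rw [Fin.forall_fin_two, hsym0, hsym1]
    exact ⟨fun ks h => sum_klAnisoFamily_eq_one_of_klE5DerivLineSym_ne_zero β μ K n₀ κ hm' hΛ0 hΛ ks (right_ne_zero_of_mul h),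
      fun ks h => sum_klAnisoFamily_eq_one_of_klE5SoftLineSym_ne_zero β μ K n₀ κ hm' hΛ0 hΛ ks h⟩
  have hs₀ : normalCovariance L M (sym 0) = (lam : ℂ) • klE5DressedSliceDeriv L M β μ K n₀ κ Λ := by
    rw [hsym0, klE5DressedSliceDeriv_eq_normalCovariance]
    ext X Y
    rw [normalCovariance_smul_symbol (fun _ => (lam : ℂ)), Matrix.smul_apply, smul_eq_mul]
  have hs₁ : normalCovariance L M (sym 1) = klE5Total L M β μ K n₀ κ - klE5DressedSlice L M β μ K n₀ κ Λ := by
    rw [hsym1, klE5Total_sub_dressedSlice_eq_normalCovariance]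
  have hκF : ∀ (t : Fin 2) (Y : SpaceTimeIdx L M × SectorLeg (sectorCount (m + 1))), Y.2.2 = 0 →
      ‖sectorGramF L M β (bgmFatMultiplier L M klE0 β (nambuXiCT L μ K) (m + 1)) (sym t) Y‖ ≤ κg t := by
    rw [Fin.forall_fin_two, hsym0, hsym1, hκg0, hκg1]; exact ⟨hκF₀, hκF₁⟩
  have hκG : ∀ (t : Fin 2) (Y : SpaceTimeIdx L M × SectorLeg (sectorCount (m + 1))), Y.2.2 = 1 →
      ‖sectorGramG L M β (bgmFatMultiplier L M klE0 β (nambuXiCT L μ K) (m + 1)) (sym t) Y‖ ≤ κg t := by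
    rw [Fin.forall_fin_two, hsym0, hsym1, hκg0, hκg1]; exact ⟨hκG₀, hκG₁⟩
  have hrow' : ∀ X, ∑ Y, ‖((sectorSubMatrix L M β (bgmFatMultiplier L M klE0 β (nambuXiCT L μ K) (m + 1))).transpose *
      normalCovariance L M (sym 0) * sectorSubMatrix L M β (bgmFatMultiplier L M klE0 β (nambuXiCT L μ K) (m + 1))) X Y‖ ≤ α := by
    rw [hsym0]; exact hrow
  have hcol' : ∀ Y, ∑ X, ‖((sectorSubMatrix L M β (bgmFatMultiplier L M klE0 β (nambuXiCT L μ K) (m + 1))).transpose *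
      normalCovariance L M (sym 0) * sectorSubMatrix L M β (bgmFatMultiplier L M klE0 β (nambuXiCT L μ K) (m + 1))) X Y‖ ≤ α := by
    rw [hsym0]; exact hcol
  have hent' : ∀ X Y, ‖((sectorSubMatrix L M β (bgmFatMultiplier L M klE0 β (nambuXiCT L μ K) (m + 1))).transpose *
      normalCovariance L M (sym 1) * sectorSubMatrix L M β (bgmFatMultiplier L M klE0 β (nambuXiCT L μ K) (m + 1))) X Y‖ ≤ δ := by
    rw [hsym1]; exact hent
  have hρ₀ := card_overlap_bgmFat_le_nine (L := L) (M := M) (e₀ := klE0) (β := β) (μ := μ) (K := K) m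
  have hρ₁ : ∀ k : FreqMomentum L M, ((univ : Finset (Fin (sectorCount (m + 1)))).filter fun ω =>
      bgmFatMultiplier L M klE0 β (nambuXiCT L μ K) (m + 1) ω k ≠ 0).card ≤ 9 :=
    card_filter_ne_zero_le_of_overlap _ fun ω => by convert hρ₀ ω
  have hx1' : x' < 1 := by linarith
  -- the uniform colouring bound
  set T : (Fin 4 → Fin 2) → ℝ := fun _ => lam⁻¹ * ((1680 * 2 ^ 9) * (α * (δ * ((4 * (9 + 9 + 4) : ℕ) : ℝ)) ^ 2 * A)) with hT_def
  have hT0 : ∀ s, 0 ≤ T s := fun s => by positivity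
  have hkey := norm_klE5Block_le_of_hybridTails_klAniso β μ K n₀ κ V Λ Qm x y hβ.ne' hm hΛ0 hΛ p T hT0 ?_
  · refine hkey.trans (le_of_eq ?_)
    rw [klE5_hybridPrefactor_eq hβ, Finset.sum_const, Finset.card_univ, nsmul_eq_mul, Fintype.card_fun, Fintype.card_fin, Fintype.card_fin]
    push_cast
    ring
  -- the colouring-wise hybrid tails
  intro s σ xp
  by_cases hs : ∃ i, s i = 0
  · -- main form: `a ≥ 1` output legs from copy `0`, pinned at one of them
    have hp := hp0 s hs
    set a := (univ.filter fun i => s i = 0).card with ha_def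
    have ha1 : 1 ≤ a := by
      obtain ⟨i, hi⟩ := hs
      exact Finset.card_pos.2 ⟨i, mem_filter.2 ⟨mem_univ _, hi⟩⟩
    have ha4 : a ≤ 4 := (card_filter_le _ _).trans (by simp)
    have hm₀ : (univ.filter fun i => s i = 0).card = (a - 1) + 1 := by omega
    have hm₁ : (univ.filter fun i => s i = 1).card = 4 - a := by rw [card_filter_eq_one_eq_four_sub]
    have henv' : ∀ k ∈ Icc 3 (Fintype.card (HubbardFieldIdx L M × Fin 2) + 2),
        (∑ t, κg t ^ 2) ^ (k - 3) * ((imagTimeWeight β M * Nf k (a - 1 + 1)) * (imagTimeWeight β M * Ne k (4 - a))) ≤ x' ^ (k - 3) * A := by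
      intro k hk
      rw [hκsum]
      have h := henv (a - 1 + 1) (mem_Icc.2 ⟨by omega, by omega⟩) k hk
      rwa [show 4 - (a - 1 + 1) = 4 - a from by omega] at h
    have h := klE5_hybridTail_le_of_lineData_pointAugment_scaled β μ K n₀ κ V Λ Qm x y hβ.le
      (klAnisoFamily L M β μ K klE0 (m + 1)) (bgmFatMultiplier L M klE0 β (nambuXiCT L μ K) (m + 1)) hρ₀ hρ₁ sym 0 1 hsym hlam hs₀ hs₁
      (klE5DressedSliceDeriv_plateau_klAnisoFamily β μ K n₀ κ hm' hΛ0 hΛ) (klE5Total_sub_dressedSlice_plateau_klAnisoFamily β μ K n₀ κ hm' hΛ0 hΛ)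
      κg hκg hκF hκG s hm₀ hm₁ (p s) hp (xp, σ (p s)) σ hα hrow' hcol' hδ hent' (fun k => Nf k (a - 1 + 1)) (fun k => Ne k (4 - a))
      (fun k => hNe0 k _) (fun k hk σ₀ => hNf k hk (a - 1 + 1) (by omega) σ₀)
      (fun k hk ω₀ τ' ω₁ => hNe k hk (4 - a) (by omega) (Fin.cons ω₀ τ') ω₁) hx0 hx1' hA henv'
    refine h.trans ?_
    rw [hT_def]
    have hK := klE5_tailConst_le (m₀ := a - 1) (m₁ := 4 - a) (by omega) hx1
    exact mul_le_mul_of_nonneg_left (mul_le_mul_of_nonneg_right hK (by positivity)) (inv_nonneg.2 hlam.le)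
  · -- all four output legs from copy `1`: the `_of_b` form, pinned at leg `0`
    have hs1 := colouring_eq_one_of_not_exists s hs
    have hp : s (p s) = 1 := hs1 _
    have hm₀ : (univ.filter fun i => s i = 0).card = 0 := by
      rw [Finset.card_eq_zero, filter_eq_empty_iff]
      exact fun i _ h0 => hs ⟨i, h0⟩
    have hm₁ : (univ.filter fun i => s i = 1).card = 3 + 1 := by
      rw [filter_true_of_mem fun i _ => hs1 i, card_univ, Fintype.card_fin]
    have henv' : ∀ k ∈ Icc 3 (Fintype.card (HubbardFieldIdx L M × Fin 2) + 2),
        (∑ t, κg t ^ 2) ^ (k - 3) * ((imagTimeWeight β M * Ne k 0) * (imagTimeWeight β M * Nf k (3 + 1))) ≤ x' ^ (k - 3) * A := by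
      intro k hk
      have h := henv 4 (mem_Icc.2 ⟨by norm_num, le_rfl⟩) k hk
      rw [show (4 : ℕ) - 4 = 0 from rfl] at h
      rw [hκsum, mul_comm (imagTimeWeight β M * Ne k 0), show (3 : ℕ) + 1 = 4 from rfl]
      exact h
    have h := klE5_hybridTail_le_of_lineData_pointAugment_scaled_of_b β μ K n₀ κ V Λ Qm x y hβ.le
      (klAnisoFamily L M β μ K klE0 (m + 1)) (bgmFatMultiplier L M klE0 β (nambuXiCT L μ K) (m + 1)) hρ₀ hρ₁ sym 0 1 hsym hlam hs₀ hs₁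
      (klE5DressedSliceDeriv_plateau_klAnisoFamily β μ K n₀ κ hm' hΛ0 hΛ) (klE5Total_sub_dressedSlice_plateau_klAnisoFamily β μ K n₀ κ hm' hΛ0 hΛ)
      κg hκg hκF hκG s hm₀ hm₁ (p s) hp (xp, σ (p s)) σ hα hrow' hcol' hδ hent' (fun k => Ne k 0) (fun k => Nf k (3 + 1))
      (fun k => hNe0 k _) (fun k hk ω₀ σ' ω₁ => hNe k hk 0 (by norm_num) (Fin.cons ω₀ σ') ω₁)
      (fun k hk σ₁ => hNf k hk (3 + 1) (by norm_num) σ₁) hx0 hx1' hA henv'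
    refine h.trans ?_
    rw [hT_def]
    have hK := klE5_tailConst_le (m₀ := 0) (m₁ := 3) (by norm_num) hx1
    exact mul_le_mul_of_nonneg_left (mul_le_mul_of_nonneg_right hK (by positivity)) (inv_nonneg.2 hlam.le)

end KlAniso

/-! ## §2 The block from RAW step data — the trivial sectorisation (first steps) -/

section Trivial

variable {L M : ℕ} [NeZero L] [NeZero M] (β μ : ℝ) (K : TrigPolyC4v) (n₀ : ℕ) (κ : FreqMomentum L M × Fin 2 → ℂ)
  (V : HubbardGrassmann L M) (Λ : ℝ) (Qm : TorusSite 2 L) (x y : TorusSite 2 L × MatsubaraIdx M)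

/-- **The E.5 block from RAW step data through the TRIVIAL sectorisation (ALL colourings)** — the twin of `norm_klE5Block_le_of_stepData_klAniso` for the
first steps (no scale below to sectorise at): `F = F̃ = trivialMultiplier` (one sector, plateau everywhere, overlap `1`), any `n₀`, any cutoff `Λ`; line data
w.r.t. `S(trivialMultiplier)`, level norms of the carrier w.r.t. `trivialMultiplier` (plain `L¹–L^∞` kernel norms), ONE envelope:
`‖klE5Block … κ V Λ Qm x y‖ ≤ 4!·ε⁻¹·(16·(λ⁻¹·(1680·2⁹·(α·(4δ)²·A))))`. [cite: BenfattoGiulianiMastropietro2006, §2.8 (2.80)] -/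
theorem norm_klE5Block_le_of_stepData_trivial (hβ : 0 < β)
    {lam : ℝ} (hlam : 0 < lam) {α κ₀ δ κ₁ : ℝ} (hα : 0 ≤ α) (hδ : 0 ≤ δ)
    (hrow : ∀ X, ∑ Y, ‖((sectorSubMatrix L M β (trivialMultiplier L M)).transpose *
        normalCovariance L M (fun ks => (lam : ℂ) * klE5DerivLineSym L M β μ K n₀ κ Λ ks) * sectorSubMatrix L M β (trivialMultiplier L M)) X Y‖ ≤ α)
    (hcol : ∀ Y, ∑ X, ‖((sectorSubMatrix L M β (trivialMultiplier L M)).transpose *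
        normalCovariance L M (fun ks => (lam : ℂ) * klE5DerivLineSym L M β μ K n₀ κ Λ ks) * sectorSubMatrix L M β (trivialMultiplier L M)) X Y‖ ≤ α)
    (hκF₀ : ∀ Y : SpaceTimeIdx L M × SectorLeg 1, Y.2.2 = 0 →
      ‖sectorGramF L M β (trivialMultiplier L M) (fun ks => (lam : ℂ) * klE5DerivLineSym L M β μ K n₀ κ Λ ks) Y‖ ≤ κ₀)
    (hκG₀ : ∀ Y : SpaceTimeIdx L M × SectorLeg 1, Y.2.2 = 1 →
      ‖sectorGramG L M β (trivialMultiplier L M) (fun ks => (lam : ℂ) * klE5DerivLineSym L M β μ K n₀ κ Λ ks) Y‖ ≤ κ₀)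
    (hent : ∀ X Y, ‖((sectorSubMatrix L M β (trivialMultiplier L M)).transpose *
        normalCovariance L M (klE5SoftLineSym L M β μ K n₀ κ Λ) * sectorSubMatrix L M β (trivialMultiplier L M)) X Y‖ ≤ δ)
    (hκF₁ : ∀ Y : SpaceTimeIdx L M × SectorLeg 1, Y.2.2 = 0 →
      ‖sectorGramF L M β (trivialMultiplier L M) (klE5SoftLineSym L M β μ K n₀ κ Λ) Y‖ ≤ κ₁)
    (hκG₁ : ∀ Y : SpaceTimeIdx L M × SectorLeg 1, Y.2.2 = 1 →
      ‖sectorGramG L M β (trivialMultiplier L M) (klE5SoftLineSym L M β μ K n₀ κ Λ) Y‖ ≤ κ₁)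
    (Nf Ne : ℕ → ℕ → ℝ) (hNe0 : ∀ k q, 0 ≤ Ne k q)
    (hNf : ∀ k ∈ Icc 3 (Fintype.card (HubbardFieldIdx L M × Fin 2) + 2), ∀ q ≤ 4, ∀ σ : Fin q → SectorLeg 1,
      hubbardSectorKernelNorm L M β (trivialMultiplier L M) (prescribedTuples univ
        (Fin.append (fun _ : Fin k => (none : Option (SectorLeg 1))) (fun j => some (σ j)))) (klE5Carrier L M β μ K n₀ κ V Λ) ≤ Nf k q)
    (hNe : ∀ k ∈ Icc 3 (Fintype.card (HubbardFieldIdx L M × Fin 2) + 2), ∀ q ≤ 4, ∀ (τ : Fin 3 → SectorLeg 1) (σ : Fin q → SectorLeg 1),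
      hubbardSectorKernelNorm L M β (trivialMultiplier L M) (prescribedTuples univ
        (Fin.append (fun i : Fin k => if h : (i : ℕ) < 3 then some (τ ⟨i, h⟩) else none) (fun j => some (σ j))))
        (klE5Carrier L M β μ K n₀ κ V Λ) ≤ Ne k q)
    {x' A : ℝ} (hx0 : 0 ≤ x') (hx1 : x' ≤ 1 / 2) (hA : 0 ≤ A)
    (henv : ∀ q ∈ Icc 1 4, ∀ k ∈ Icc 3 (Fintype.card (HubbardFieldIdx L M × Fin 2) + 2),
      (κ₀ ^ 2 + κ₁ ^ 2) ^ (k - 3) * ((imagTimeWeight β M * Nf k q) * (imagTimeWeight β M * Ne k (4 - q))) ≤ x' ^ (k - 3) * A) :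
    ‖klE5Block L M β μ K n₀ κ V Λ Qm x y‖ ≤
      ((4 : ℕ).factorial : ℝ) * (imagTimeWeight β M)⁻¹ * (16 * (lam⁻¹ * ((1680 * 2 ^ 9) * (α * (4 * δ) ^ 2 * A)))) := by
  classical
  -- the pinned leg of a colouring: one of colour `0` if there is one, else leg `0`
  obtain ⟨p, hp0, hp1⟩ : ∃ p : (Fin 4 → Fin 2) → Fin 4,
      (∀ s : Fin 4 → Fin 2, (∃ i, s i = 0) → s (p s) = 0) ∧ (∀ s : Fin 4 → Fin 2, (¬ ∃ i, s i = 0) → p s = 0) :=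
    ⟨fun s : Fin 4 → Fin 2 => if h : ∃ i, s i = 0 then h.choose else (0 : Fin 4),
      fun s h => by dsimp only; rw [dif_pos h]; exact h.choose_spec, fun s h => by dsimp only; rw [dif_neg h]⟩
  obtain ⟨sym, hsym0, hsym1⟩ : ∃ sym : Fin 2 → FreqMomentum L M × Fin 2 → ℂ,
      sym 0 = (fun ks => (lam : ℂ) * klE5DerivLineSym L M β μ K n₀ κ Λ ks) ∧ sym 1 = klE5SoftLineSym L M β μ K n₀ κ Λ :=
    ⟨![fun ks => (lam : ℂ) * klE5DerivLineSym L M β μ K n₀ κ Λ ks, klE5SoftLineSym L M β μ K n₀ κ Λ], rfl, rfl⟩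
  obtain ⟨κg, hκg0, hκg1⟩ : ∃ κg : Fin 2 → ℝ, κg 0 = κ₀ ∧ κg 1 = κ₁ := ⟨![κ₀, κ₁], rfl, rfl⟩
  have hκsum : ∑ t, κg t ^ 2 = κ₀ ^ 2 + κ₁ ^ 2 := by rw [Fin.sum_univ_two, hκg0, hκg1]
  have hs₀ : normalCovariance L M (sym 0) = (lam : ℂ) • klE5DressedSliceDeriv L M β μ K n₀ κ Λ := by
    rw [hsym0, klE5DressedSliceDeriv_eq_normalCovariance]
    ext X Y
    rw [normalCovariance_smul_symbol (fun _ => (lam : ℂ)), Matrix.smul_apply, smul_eq_mul]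
  have hs₁ : normalCovariance L M (sym 1) = klE5Total L M β μ K n₀ κ - klE5DressedSlice L M β μ K n₀ κ Λ := by
    rw [hsym1, klE5Total_sub_dressedSlice_eq_normalCovariance]
  have hκF : ∀ (t : Fin 2) (Y : SpaceTimeIdx L M × SectorLeg 1), Y.2.2 = 0 → ‖sectorGramF L M β (trivialMultiplier L M) (sym t) Y‖ ≤ κg t := by
    rw [Fin.forall_fin_two, hsym0, hsym1, hκg0, hκg1]; exact ⟨hκF₀, hκF₁⟩
  have hκG : ∀ (t : Fin 2) (Y : SpaceTimeIdx L M × SectorLeg 1), Y.2.2 = 1 → ‖sectorGramG L M β (trivialMultiplier L M) (sym t) Y‖ ≤ κg t := by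
    rw [Fin.forall_fin_two, hsym0, hsym1, hκg0, hκg1]; exact ⟨hκG₀, hκG₁⟩
  have hrow' : ∀ X, ∑ Y, ‖((sectorSubMatrix L M β (trivialMultiplier L M)).transpose * normalCovariance L M (sym 0) *
      sectorSubMatrix L M β (trivialMultiplier L M)) X Y‖ ≤ α := by
    rw [hsym0]; exact hrow
  have hcol' : ∀ Y, ∑ X, ‖((sectorSubMatrix L M β (trivialMultiplier L M)).transpose * normalCovariance L M (sym 0) *
      sectorSubMatrix L M β (trivialMultiplier L M)) X Y‖ ≤ α := by
    rw [hsym0]; exact hcol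
  have hent' : ∀ X Y, ‖((sectorSubMatrix L M β (trivialMultiplier L M)).transpose * normalCovariance L M (sym 1) *
      sectorSubMatrix L M β (trivialMultiplier L M)) X Y‖ ≤ δ := by
    rw [hsym1]; exact hent
  have hρ₀ : ∀ ω : Fin 1, ((univ : Finset (Fin 1)).filter fun ω' => ∃ q, trivialMultiplier L M ω q * trivialMultiplier L M ω' q ≠ 0).card ≤ 1 :=
    fun ω => (card_filter_le _ _).trans (by simp)
  have hx1' : x' < 1 := by linarith
  set T : (Fin 4 → Fin 2) → ℝ := fun _ => lam⁻¹ * ((1680 * 2 ^ 9) * (α * (δ * ((4 * 1 : ℕ) : ℝ)) ^ 2 * A)) with hT_def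
  have hT0 : ∀ s, 0 ≤ T s := fun s => by positivity
  have hkey := norm_klE5Block_le_of_hybridTails_trivial β μ K n₀ κ V Λ Qm x y hβ.ne' p T hT0 ?_
  · refine hkey.trans (le_of_eq ?_)
    rw [klE5_hybridPrefactor_eq hβ, Finset.sum_const, Finset.card_univ, nsmul_eq_mul, Fintype.card_fun, Fintype.card_fin, Fintype.card_fin]
    push_cast
    ring
  intro s σ xp
  by_cases hs : ∃ i, s i = 0
  · have hp := hp0 s hs
    set a := (univ.filter fun i => s i = 0).card with ha_def
    have ha1 : 1 ≤ a := by
      obtain ⟨i, hi⟩ := hs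
      exact Finset.card_pos.2 ⟨i, mem_filter.2 ⟨mem_univ _, hi⟩⟩
    have ha4 : a ≤ 4 := (card_filter_le _ _).trans (by simp)
    have hm₀ : (univ.filter fun i => s i = 0).card = (a - 1) + 1 := by omega
    have hm₁ : (univ.filter fun i => s i = 1).card = 4 - a := by rw [card_filter_eq_one_eq_four_sub]
    have henv' : ∀ k ∈ Icc 3 (Fintype.card (HubbardFieldIdx L M × Fin 2) + 2),
        (∑ t, κg t ^ 2) ^ (k - 3) * ((imagTimeWeight β M * Nf k (a - 1 + 1)) * (imagTimeWeight β M * Ne k (4 - a))) ≤ x' ^ (k - 3) * A := by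
      intro k hk
      rw [hκsum]
      have h := henv (a - 1 + 1) (mem_Icc.2 ⟨by omega, by omega⟩) k hk
      rwa [show 4 - (a - 1 + 1) = 4 - a from by omega] at h
    have h := klE5_hybridTail_le_of_lineData_scaled β μ K n₀ κ V Λ hβ.le (trivialMultiplier L M) (trivialMultiplier L M) hρ₀ sym 0 1 hlam hs₀ hs₁
      κg hκF hκG s hm₀ hm₁ (p s) hp (xp, σ (p s)) σ hα hrow' hcol' hδ hent' (fun k => Nf k (a - 1 + 1)) (fun k => Ne k (4 - a))
      (fun k => hNe0 k _) (fun k hk σ₀ => hNf k hk (a - 1 + 1) (by omega) σ₀)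
      (fun k hk ω₀ τ' ω₁ => hNe k hk (4 - a) (by omega) (Fin.cons ω₀ τ') ω₁) hx0 hx1' hA henv'
    refine h.trans ?_
    rw [hT_def]
    have hK := klE5_tailConst_le (m₀ := a - 1) (m₁ := 4 - a) (by omega) hx1
    exact mul_le_mul_of_nonneg_left (mul_le_mul_of_nonneg_right hK (by positivity)) (inv_nonneg.2 hlam.le)
  · have hs1 := colouring_eq_one_of_not_exists s hs
    have hp : s (p s) = 1 := hs1 _
    have hm₀ : (univ.filter fun i => s i = 0).card = 0 := by
      rw [Finset.card_eq_zero, filter_eq_empty_iff]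
      exact fun i _ h0 => hs ⟨i, h0⟩
    have hm₁ : (univ.filter fun i => s i = 1).card = 3 + 1 := by
      rw [filter_true_of_mem fun i _ => hs1 i, card_univ, Fintype.card_fin]
    have henv' : ∀ k ∈ Icc 3 (Fintype.card (HubbardFieldIdx L M × Fin 2) + 2),
        (∑ t, κg t ^ 2) ^ (k - 3) * ((imagTimeWeight β M * Ne k 0) * (imagTimeWeight β M * Nf k (3 + 1))) ≤ x' ^ (k - 3) * A := by
      intro k hk
      have h := henv 4 (mem_Icc.2 ⟨by norm_num, le_rfl⟩) k hk
      rw [show (4 : ℕ) - 4 = 0 from rfl] at h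
      rw [hκsum, mul_comm (imagTimeWeight β M * Ne k 0), show (3 : ℕ) + 1 = 4 from rfl]
      exact h
    have h := klE5_hybridTail_le_of_lineData_scaled_of_b β μ K n₀ κ V Λ hβ.le (trivialMultiplier L M) (trivialMultiplier L M) hρ₀ sym 0 1 hlam
      hs₀ hs₁ κg hκF hκG s hm₀ hm₁ (p s) hp (xp, σ (p s)) σ hα hrow' hcol' hδ hent' (fun k => Ne k 0) (fun k => Nf k (3 + 1))
      (fun k => hNe0 k _) (fun k hk ω₀ σ' ω₁ => hNe k hk 0 (by norm_num) (Fin.cons ω₀ σ') ω₁)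
      (fun k hk σ₁ => hNf k hk (3 + 1) (by norm_num) σ₁) hx0 hx1' hA henv'
    refine h.trans ?_
    rw [hT_def]
    have hK := klE5_tailConst_le (m₀ := 0) (m₁ := 3) (by norm_num) hx1
    exact mul_le_mul_of_nonneg_left (mul_le_mul_of_nonneg_right hK (by positivity)) (inv_nonneg.2 hlam.le)

end Trivial

end Summit.HubbardSuperconductivity.HubbardSuperconductivity.Theorems.KLRegimeSplit

end
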